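import Literature.MathematicalPhysics.QuantumFieldTheory.Balaban1983to89.T4InputCauchyRateSharp
import Literature.MathematicalPhysics.QuantumFieldTheory.Balaban1983to89.T4OperatorRateLiaison

/-!
# OutputRateResidual — the NE5 RESIDUAL of binder row NE5 (node U3) as ONE Summits-side statement: `T4OutputRate.NE5` from
# the typed walls W1 (operator rate, fed in the liaison's ENTRYWISE / `LocalRate` currencies), W2 (data-Lipschitz modulus of the
# one step), W3/W4 (insertion scale bound / insertion rate), MI-R (representation of both runs by one step model), the
# smallness S and the reach R — every conditional a NAMED binder; both the slower-rate face and the Sharp threshold face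
# (cell `pub-balaban`, T⁴-continuum fan-out, `HOME/BINDER-OWNERS.md` row NE5, owner lineage t4-ne5-p1, gen 22; tree target
# `Summits/QuantumFields/BalabanUV/T4Continuum/Support/`, LEAN PLACEMENT RULE 2026-08-19: the cell's own bookkeeping lives under
# `Summits/`, published statements only under `Literature/`)

HONEST FRAMING (T4-DAG PAGE 1).  The cell's T⁴ target is rung (B)+1: existence AND uniqueness of the ε → 0 limit of Bałaban's
unit-scale averaged gauge-invariant expectations on a FIXED finite torus T⁴ — NOT infinite volume, NOT a mass gap, NOT the Clay
problem; the spine's conditionals (`FlowStep.BetaPertH`, (B), (B^μ)) are untouched and NOT hidden here.  The spine estimate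
NE5 ("η-rate of the one-step outputs E^{(j)}(X; g, U) as functionals of V", shape `T4OutputRate.NE5`) is NOT PRINTED in
[Balaban1987RG1]–[Balaban1989LargeFieldII] (the papers print ε-UNIFORM BOUNDS — [II] (2.38)–(2.41), [III] (2.40)–(2.42) —
never two-spacing RATES; cell GAPS G-t4-U3-1) and is NOT PROVED here or anywhere in the tree: Bałaban's functionals (2.13) of
[I] are not constructed in the tree, so every `StepModel` below is ABSTRACT DATA and every wall is a HYPOTHESIS SHAPE of the
imported Literature leaves, consumed BY NAME.  Nothing printed is asserted; no «…» print quotation is introduced by this module (0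
cite tags; the located print of each wall is in the imported leaves' docstrings and in the lineage record
`t4/T4-EST-NE5-P1.md`, walls sheet `t4/b2b-balaban-t4-ne5-p1/WALLS-NE5-P1.md` v13).  Spine estimates PROVED: 0/9, unchanged.
HONEST DEPENDENCY (cell, verbatim): continuum YM on T⁴ ⇐ BetaPertH ∧ nine spine estimates (0/9 proved); BetaPertH ⇐ (D1) ∧ (D4)
∧ CAP+tail; G-an2-4 gates asym, D1 and NE2/3/4.

WHAT THIS MODULE IS.  The row-NE5 owner's dated deliverable "instantiate W1 BY NAME through `T4OperatorRateLiaison` and restate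
the residual NE5 ⇐ W2 ∧ W3 ∧ W4 ∧ MI-R ∧ S ∧ R as ONE Summits Support leaf" (BINDER-OWNERS row NE5, ETA cell).  The six
Literature leaves of the Cauchy route (`T4InputCauchyRate{,Data,Species,Termwise,Secant,Sharp}`) prove the reduction over an
abstract `StepModel` with W1 = `StepModel.OperatorRate W δ θ` (margin units); the liaison `T4OperatorRateLiaison` proves the
currency conversions from node U1a's producer-side currencies — `EntrywiseRate` (normalised (3.42)-type entries × King rate
factors, sup norm over a finite entry set) and the `T4EtaRateMin.LocalRate` SHAPE (one consecutive-step scalar discrepancy per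
entry; the channel through which the tree's one hypothesis-free instance, `T4Cov2156Rate.cov2156_localRate` for the unit-lattice
covariance species at U = 1, would enter) — into `OperatorRate`.  This module COMPOSES the two, so that the residual of row NE5
reads as single theorems whose W1 binder is ALREADY in the currency NE2's producer statement will deliver (instantiation of
`EntrywiseRate`/`LocalRate` by NE2 ∧ NE3's landed statement = row item (i), due ≤ 1 generation after those land; nothing of it
is anticipated here):

* §1 `operatorRate_of_entrywise_floor`, `operatorRate_of_localRate_floor` (and the liaison's `operatorRate_of_absRate_floor` BY NAME) — W1 in margin units from the entrywise / `LocalRate`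
  currencies under UNIT rate factors (`rf k s ≤ θ^k`: operator species localised at unit-size sites, liaison (L2)) and an
  [I]-type margin FLOOR `r₀ ≤ rOp k` (liaison (L3)); constant `δ = c₁/r₀`.
* §2 `ne5_at_of_entrywise_lip_nat` — THE RESIDUAL, slower-rate face: NE5 at every `θ′ ∈ [θ, 1]` with `ω + Λ·c < θ′` (S) from
  W1 (entrywise) ∧ W2 (`DataLipschitz κ Λ ρ₀`) ∧ W4 (`InsertionRate`) ∧ W3 in its consumed form (`InsertionDampedNat κ c ω`;
  the structural producer `InsAffine ∧ InsBlind ∧ InsHomog ∧ InsScaleBound` of the Data leaf §9 feeds it by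
  `insertionDampedNat_of_affine ∘ sizeDampedNat_of_scaleBound`, variant `ne5_at_of_entrywise_scale_lip_nat`) ∧ MI-R
  (`RepresentsA`, `RepresentsB`, `InBase`) ∧ one-run decay bounds ∧ R (`hnear`, first scales `hfirst`); constant
  `((Λ·(c₁/r₀ + δ′) + B)(θ′ − ω))/(θ′ − (ω + Λ·c))` — the Data leaf's `ne5_at_of_stepModel_lip_nat` with W1 converted.
* §3 `ne5_threshold_of_entrywise_lip_nat` — the Sharp face: NO smallness hypothesis, NE5 AT the threshold rate `ω + Λ·c` itself
  when the input rate is faster (`θ < ω + Λ·c`), constant `(Λ(c₁/r₀ + δ′) + B)·max 1 (Λc/(ω + Λc − θ))` — the Sharp leaf's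
  `ne5_threshold_of_stepModel_lip_nat` with W1 converted.
* §4 `ne5_at_of_localRate_lip_nat` — §2 through the `LocalRate` channel (liaison (A1′)).
* §5 `exists_ne5_of_entrywise_lip_nat` — the ∃-form a consumer of "some rate θ′ < 1" needs: room `ω + Λ·c < 1` and `θ < 1`
  suffice.
* §5b `exists_ne5_of_absRate_poly` — the [III]-type face of the node-U3 record's (C5) dichotomy: operator margins shrinking
  POLYNOMIALLY in the step (`MarginFloorPoly`, liaison (L3)) cost RATE (an ∃ over `θ′ < 1` and `C₅`), not existence — W1 as an
  absolute rate `δ₀θ₀^k`, `θ₀ < 1`, reach `ρ₀` strictly above the fed-back one-run level, room `ω + Λ·c < 1`; with the two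
  elementary lemmas it needs (`insertionRate_mono`, `first_scales_const`).
* §6 NON-VACUITY on the imported toys (`T4InputCauchyRateData.toyModel`: absolute rate (1/2)^k, unit margins, exact modulus
  Λ = 1, gain c = ω = 1/64): the §2 face fires with constant 31/30 at θ′ = 1/2 from the liaison's `toy_absRate`/`toy_marginFloor`
  (a re-reading as a one-entry `EntrywiseRate` is not needed: the liaison's floor lemma takes `AbsOperatorRate`), and a
  NEGATIVE CONTROL: the liaison's `finestToyModel` (one lattice-scale entry with a persistent artefact) admits NO W1 with θ < 1
  (`finestToy_not_operatorRate` BY NAME, as an `example`), so §2 cannot be fed from it — the typed form of liaison (L2)'s obstruction, recorded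
  here so that a consumer sees on one page what an instantiation must avoid.

WHAT IS PROVED: real bookkeeping only (composition of the imported closures with the imported currency conversions; one
`max`/`linarith` step in §5).  0 sorry; axioms ⊆ {propext, Classical.choice, Quot.sound}; imports the LANDED modules
`T4InputCauchyRateSharp` v1.1 (p192986; it imports the whole Cauchy chain) and `T4OperatorRateLiaison` v1.1 BY NAME and
modifies nothing of them.  NOT COVERED: any instance of a wall for Bałaban's objects; the species list / entry set / rate
factors of an instantiation (a READING of [II]'s step, liaison (L2)); NE2, NE3, BetaPertH, (B), (B^μ).
-/

noncomputable section

open Set Finset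

namespace Summit.QuantumFields.BalabanUV.T4Continuum.OutputRateResidual

open Literature.MathematicalPhysics.QuantumFieldTheory.Balaban1983to89
open Literature.MathematicalPhysics.QuantumFieldTheory.Balaban1983to89.T4OutputRate
open Literature.MathematicalPhysics.QuantumFieldTheory.Balaban1983to89.T4InputCauchyRate
open Literature.MathematicalPhysics.QuantumFieldTheory.Balaban1983to89.T4InputCauchyRateData
open Literature.MathematicalPhysics.QuantumFieldTheory.Balaban1983to89.T4InputCauchyRateSharp
open Literature.MathematicalPhysics.QuantumFieldTheory.Balaban1983to89.T4OperatorRateLiaison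
open Literature.MathematicalPhysics.QuantumFieldTheory.Balaban1983to89.T4EtaRateMin

/-! ## §1 W1 in margin units from the liaison's producer-side currencies -/

section WallOne

variable {C : Carriers} {Op Hist : Type*} [NormedAddCommGroup Op] [NormedSpace ℂ Op] [NormedAddCommGroup Hist]
  [NormedSpace ℂ Hist]

/- W1 from an ABSOLUTE rate and an [I]-type margin floor — `AbsOperatorRate δ₀ θ` + `r₀ ≤ rOp k` ⇒ `OperatorRate (δ₀/r₀) θ` —
is the liaison's `operatorRate_of_absRate_floor` BY NAME (used as is in §5b and §6; not re-declared). -/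

variable {S : Type*} [Fintype S]

/-- **W1 IN THE ENTRYWISE CURRENCY.**  If the two runs' operator data, entry by entry over a finite entry set `S`, differ by at
most `c₁ × (rate factor)` (`EntrywiseRate`, the shape NE2's producer statement instantiates), every rate factor at step `k` is at
most `θ^k` (UNIT-size localisation sites, liaison (L2)), and the operator margins have the floor `r₀ > 0` ([I]-type absolute
margins, liaison (L3)), then W1 holds in margin units with `δ = c₁/r₀` at rate `θ`. [folklore] -/
theorem operatorRate_of_entrywise_floor (M : StepModel C (S → ℂ) Hist) {W : Set (ℕ → ℝ)} {c₁ θ r₀ : ℝ}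
    {rf : ℕ → S → ℝ} (hent : EntrywiseRate M W c₁ rf) (hunit : ∀ k s, rf k s ≤ θ ^ k) (hfl : ∀ k, r₀ ≤ M.rOp k)
    (hr₀ : 0 < r₀) (hc₁ : 0 ≤ c₁) (hθ : 0 ≤ θ) : M.OperatorRate W (c₁ / r₀) θ :=
  operatorRate_of_absRate_floor M (absRate_of_entrywise M hent hunit hc₁ hθ) hfl hr₀ hc₁ hθ

/-- **W1 IN THE `LocalRate` CURRENCY** (liaison (A1′)): if every entry of the operator discrepancy at step `k` is dominated by
ONE consecutive-step discrepancy of a `Readings` carrier `R` (datum `v`, site `e` chosen per step / couplings / background /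
entry) and `LocalRate R Cr θ` holds, then with the margin floor `r₀` W1 holds with `δ = Cr/r₀`. [folklore] -/
theorem operatorRate_of_localRate_floor (M : StepModel C (S → ℂ) Hist) {ι X : Type*} (R : Readings ι X) {Cr θ r₀ : ℝ}
    (hR : LocalRate R Cr θ) (hCr : 0 ≤ Cr) (hθ : 0 ≤ θ) {W : Set (ℕ → ℝ)} (v : ℕ → (ℕ → ℝ) → C.BgB → S → ι)
    (e : ℕ → (ℕ → ℝ) → C.BgB → S → X) (hv : ∀ k, ∀ g ∈ W, ∀ (U : C.BgB) (s : S), v k g U s ∈ R.dom)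
    (hdom : ∀ k, ∀ g ∈ W, ∀ (U : C.BgB) (s : S),
      ‖M.opA g U k s - M.opB g U k s‖ ≤ |R.loc (k + 1) (v k g U s) (e k g U s) - R.loc k (v k g U s) (e k g U s)|)
    (hfl : ∀ k, r₀ ≤ M.rOp k) (hr₀ : 0 < r₀) : M.OperatorRate W (Cr / r₀) θ :=
  operatorRate_of_absRate_floor M (absRate_of_localRate M R hR hCr hθ v e hv hdom) hfl hr₀ hCr hθ

end WallOne

/-! ## §2 The residual, slower-rate face -/

section Residual

variable {C : Carriers} {S Hist : Type*} [Fintype S] [NormedAddCommGroup Hist] [NormedSpace ℂ Hist]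
  (M : StepModel C (S → ℂ) Hist)

/-- **ROW NE5 RESIDUAL — SLOWER-RATE FACE.**  `T4OutputRate.NE5 EA EB W κ θ′ C₅` for the two runs' output functionals `EA`,
`EB`, from the NAMED binders: MI-R = `hrA`/`hrB`/`hbase` (both runs represented by the one step model `M`, run B's data in the
one-run class); W2 = `hlip` (`DataLipschitz κ Λ ρ₀`: the one step's Lipschitz modulus `Λ` in margin units within relative reach
`ρ₀`); one-run decay levels `hdA`/`hdB`; W1 = `hent` ∧ `hunit` ∧ `hfl` (entrywise currency, §1); W4 = `hins` (`InsertionRate κ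
E₀ δ′ θ`); W3 consumed = `hdamp` (`InsertionDampedNat κ c ω`); R = `hnear` (from scale `k₀` on the data are within reach) ∧
`hfirst` (the first `k₀` scales, constant `B`); S = `hsmall` (`ω + Λ·c < θ′`).  Conclusion at every `θ′ ∈ [θ, 1]` past the
threshold, constant `(Λ(c₁/r₀ + δ′) + B)(θ′ − ω)/(θ′ − (ω + Λc))`. [folklore] -/
theorem ne5_at_of_entrywise_lip_nat {EA : Functional C C.BgA} {EB : Functional C C.BgB} {W : Set (ℕ → ℝ)}
    {κ Λ EA₀ E₀ c₁ r₀ δ' θ θ' c ω ρ₀ B : ℝ} {rf : ℕ → S → ℝ} {k₀ : ℕ} (hrA : M.RepresentsA EA W)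
    (hrB : M.RepresentsB EB W) (hbase : M.InBase EB W) (hlip : M.DataLipschitz W κ Λ ρ₀) (hdA : DecayBound EA W EA₀ κ)
    (hdB : DecayBound EB W E₀ κ) (hent : EntrywiseRate M W c₁ rf) (hunit : ∀ k s, rf k s ≤ θ ^ k)
    (hfl : ∀ k, r₀ ≤ M.rOp k) (hr₀ : 0 < r₀) (hc₁ : 0 ≤ c₁) (hins : M.InsertionRate W κ E₀ δ' θ)
    (hdamp : M.InsertionDampedNat W κ c ω) (hΛ : 0 ≤ Λ) (hδ' : 0 ≤ δ') (hθ : 0 ≤ θ) (hθθ' : θ ≤ θ') (hθ'1 : θ' ≤ 1)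
    (hc : 0 ≤ c) (hω : 0 < ω) (hnear : (c₁ / r₀ + δ') * θ ^ k₀ + c * (EA₀ + E₀) / (1 - ω) ≤ ρ₀) (hB : 0 ≤ B)
    (hfirst : ∀ k < k₀, EA₀ + E₀ ≤ B * θ ^ k) (hsmall : ω + Λ * c < θ') :
    NE5 EA EB W κ θ' ((Λ * (c₁ / r₀ + δ') + B) * (θ' - ω) / (θ' - (ω + Λ * c))) :=
  M.ne5_at_of_stepModel_lip_nat hrA hrB hbase hlip hdA hdB (operatorRate_of_entrywise_floor M hent hunit hfl hr₀ hc₁ hθ)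
    hins hdamp hΛ (add_nonneg (div_nonneg hc₁ hr₀.le) hδ') hθ hθθ' hθ'1 hc hω hnear hB hfirst hsmall

/-- The same with W3 in its STRUCTURAL producer form (Data leaf §9): `InsAffine ∧ InsBlind ∧ InsHomog` + the displayed
single-scale term `InsScaleBound κ E₁ c ω` in place of `InsertionDampedNat`. [folklore] -/
theorem ne5_at_of_entrywise_scale_lip_nat {EA : Functional C C.BgA} {EB : Functional C C.BgB} {W : Set (ℕ → ℝ)}
    {κ Λ EA₀ E₀ E₁ c₁ r₀ δ' θ θ' c ω ρ₀ B : ℝ} {rf : ℕ → S → ℝ} {k₀ : ℕ} (hrA : M.RepresentsA EA W)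
    (hrB : M.RepresentsB EB W) (hbase : M.InBase EB W) (hlip : M.DataLipschitz W κ Λ ρ₀) (hdA : DecayBound EA W EA₀ κ)
    (hdB : DecayBound EB W E₀ κ) (hent : EntrywiseRate M W c₁ rf) (hunit : ∀ k s, rf k s ≤ θ ^ k)
    (hfl : ∀ k, r₀ ≤ M.rOp k) (hr₀ : 0 < r₀) (hc₁ : 0 ≤ c₁) (hins : M.InsertionRate W κ E₀ δ' θ)
    (haff : M.InsAffine W) (hblind : M.InsBlind W) (hhom : M.InsHomog W) (hscale : M.InsScaleBound W κ E₁ c ω)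
    (hE₁ : 0 < E₁) (hΛ : 0 ≤ Λ) (hδ' : 0 ≤ δ') (hθ : 0 ≤ θ) (hθθ' : θ ≤ θ') (hθ'1 : θ' ≤ 1) (hc : 0 ≤ c) (hω : 0 < ω)
    (hnear : (c₁ / r₀ + δ') * θ ^ k₀ + c * (EA₀ + E₀) / (1 - ω) ≤ ρ₀) (hB : 0 ≤ B)
    (hfirst : ∀ k < k₀, EA₀ + E₀ ≤ B * θ ^ k) (hsmall : ω + Λ * c < θ') :
    NE5 EA EB W κ θ' ((Λ * (c₁ / r₀ + δ') + B) * (θ' - ω) / (θ' - (ω + Λ * c))) :=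
  ne5_at_of_entrywise_lip_nat M hrA hrB hbase hlip hdA hdB hent hunit hfl hr₀ hc₁ hins
    (M.insertionDampedNat_of_affine haff (M.sizeDampedNat_of_scaleBound haff hblind hhom hscale hE₁)) hΛ hδ' hθ hθθ' hθ'1
    hc hω hnear hB hfirst hsmall

end Residual

/-! ## §3 The residual, Sharp threshold face (no smallness hypothesis) -/

section Threshold

variable {C : Carriers} {S Hist : Type*} [Fintype S] [NormedAddCommGroup Hist] [NormedSpace ℂ Hist]
  (M : StepModel C (S → ℂ) Hist)

/-- **ROW NE5 RESIDUAL — THRESHOLD FACE.**  With the same binders as §2 EXCEPT the smallness S, and the input rate strictly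
faster than the threshold (`θ < ω + Λ·c`, `ω < 1`), NE5 holds AT the threshold rate `ω + Λ·c` with the k-uniform constant
`(Λ(c₁/r₀ + δ′) + B)·max 1 (Λc/(ω + Λc − θ))` (the Sharp leaf's renewal solution; the threshold is attained off resonance and
is the exact infimum of NE5 rates on the Sharp leaf's witness family). [folklore] -/
theorem ne5_threshold_of_entrywise_lip_nat {EA : Functional C C.BgA} {EB : Functional C C.BgB} {W : Set (ℕ → ℝ)}
    {κ Λ EA₀ E₀ c₁ r₀ δ' θ c ω ρ₀ B : ℝ} {rf : ℕ → S → ℝ} {k₀ : ℕ} (hrA : M.RepresentsA EA W)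
    (hrB : M.RepresentsB EB W) (hbase : M.InBase EB W) (hlip : M.DataLipschitz W κ Λ ρ₀) (hdA : DecayBound EA W EA₀ κ)
    (hdB : DecayBound EB W E₀ κ) (hent : EntrywiseRate M W c₁ rf) (hunit : ∀ k s, rf k s ≤ θ ^ k)
    (hfl : ∀ k, r₀ ≤ M.rOp k) (hr₀ : 0 < r₀) (hc₁ : 0 ≤ c₁) (hins : M.InsertionRate W κ E₀ δ' θ)
    (hdamp : M.InsertionDampedNat W κ c ω) (hΛ : 0 ≤ Λ) (hδ' : 0 ≤ δ') (hθ : 0 ≤ θ) (hθ1 : θ ≤ 1) (hc : 0 ≤ c)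
    (hω : 0 < ω) (hω1 : ω < 1) (hnear : (c₁ / r₀ + δ') * θ ^ k₀ + c * (EA₀ + E₀) / (1 - ω) ≤ ρ₀) (hB : 0 ≤ B)
    (hfirst : ∀ k < k₀, EA₀ + E₀ ≤ B * θ ^ k) (hsub : θ < ω + Λ * c) :
    NE5 EA EB W κ (ω + Λ * c) ((Λ * (c₁ / r₀ + δ') + B) * max 1 (Λ * c / (ω + Λ * c - θ))) :=
  ne5_threshold_of_stepModel_lip_nat M hrA hrB hbase hlip hdA hdB
    (operatorRate_of_entrywise_floor M hent hunit hfl hr₀ hc₁ hθ) hins hdamp hΛ (add_nonneg (div_nonneg hc₁ hr₀.le) hδ')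
    hθ hθ1 hc hω hω1 hnear hB hfirst hsub

end Threshold

/-! ## §4 The residual through the `LocalRate` channel -/

section LocalRateChannel

variable {C : Carriers} {S Hist : Type*} [Fintype S] [NormedAddCommGroup Hist] [NormedSpace ℂ Hist]
  (M : StepModel C (S → ℂ) Hist)

/-- **ROW NE5 RESIDUAL — `LocalRate` CHANNEL.**  §2 with W1 fed by a `Readings` carrier `R` satisfying `LocalRate R Cr θ` BY
NAME and an entrywise domination of the operator discrepancy by `R`'s consecutive-step discrepancies (liaison (A1′));
`δ = Cr/r₀`. [folklore] -/
theorem ne5_at_of_localRate_lip_nat {ι X : Type*} (R : Readings ι X) {EA : Functional C C.BgA} {EB : Functional C C.BgB}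
    {W : Set (ℕ → ℝ)} {κ Λ EA₀ E₀ Cr r₀ δ' θ θ' c ω ρ₀ B : ℝ} {k₀ : ℕ} (hrA : M.RepresentsA EA W)
    (hrB : M.RepresentsB EB W) (hbase : M.InBase EB W) (hlip : M.DataLipschitz W κ Λ ρ₀) (hdA : DecayBound EA W EA₀ κ)
    (hdB : DecayBound EB W E₀ κ) (hR : LocalRate R Cr θ) (hCr : 0 ≤ Cr) (v : ℕ → (ℕ → ℝ) → C.BgB → S → ι)
    (e : ℕ → (ℕ → ℝ) → C.BgB → S → X) (hv : ∀ k, ∀ g ∈ W, ∀ (U : C.BgB) (s : S), v k g U s ∈ R.dom)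
    (hdom : ∀ k, ∀ g ∈ W, ∀ (U : C.BgB) (s : S),
      ‖M.opA g U k s - M.opB g U k s‖ ≤ |R.loc (k + 1) (v k g U s) (e k g U s) - R.loc k (v k g U s) (e k g U s)|)
    (hfl : ∀ k, r₀ ≤ M.rOp k) (hr₀ : 0 < r₀) (hins : M.InsertionRate W κ E₀ δ' θ) (hdamp : M.InsertionDampedNat W κ c ω)
    (hΛ : 0 ≤ Λ) (hδ' : 0 ≤ δ') (hθ : 0 ≤ θ) (hθθ' : θ ≤ θ') (hθ'1 : θ' ≤ 1) (hc : 0 ≤ c) (hω : 0 < ω)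
    (hnear : (Cr / r₀ + δ') * θ ^ k₀ + c * (EA₀ + E₀) / (1 - ω) ≤ ρ₀) (hB : 0 ≤ B)
    (hfirst : ∀ k < k₀, EA₀ + E₀ ≤ B * θ ^ k) (hsmall : ω + Λ * c < θ') :
    NE5 EA EB W κ θ' ((Λ * (Cr / r₀ + δ') + B) * (θ' - ω) / (θ' - (ω + Λ * c))) :=
  M.ne5_at_of_stepModel_lip_nat hrA hrB hbase hlip hdA hdB
    (operatorRate_of_localRate_floor M R hR hCr hθ v e hv hdom hfl hr₀) hins hdamp hΛ
    (add_nonneg (div_nonneg hCr hr₀.le) hδ') hθ hθθ' hθ'1 hc hω hnear hB hfirst hsmall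

end LocalRateChannel

/-! ## §5 The ∃-form: room suffices for SOME rate -/

section Exists

variable {C : Carriers} {S Hist : Type*} [Fintype S] [NormedAddCommGroup Hist] [NormedSpace ℂ Hist]
  (M : StepModel C (S → ℂ) Hist)

/-- **EXISTENCE OF AN NE5 RATE NEEDS ONLY ROOM.**  Under the binders of §2 at an input rate `θ < 1`, the single condition
`ω + Λ·c < 1` (history age damping plus feedback modulus × gain below one) yields SOME rate `θ′ < 1` and a constant with
`NE5 EA EB W κ θ′ C₅` (witness `θ′ = max θ ((ω + Λc + 1)/2)`).  This is the form a consumer asking only for "a rate" takes;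
the SIZE of the exponent is the census item S of the walls sheet. [folklore] -/
theorem exists_ne5_of_entrywise_lip_nat {EA : Functional C C.BgA} {EB : Functional C C.BgB} {W : Set (ℕ → ℝ)}
    {κ Λ EA₀ E₀ c₁ r₀ δ' θ c ω ρ₀ B : ℝ} {rf : ℕ → S → ℝ} {k₀ : ℕ} (hrA : M.RepresentsA EA W)
    (hrB : M.RepresentsB EB W) (hbase : M.InBase EB W) (hlip : M.DataLipschitz W κ Λ ρ₀) (hdA : DecayBound EA W EA₀ κ)
    (hdB : DecayBound EB W E₀ κ) (hent : EntrywiseRate M W c₁ rf) (hunit : ∀ k s, rf k s ≤ θ ^ k)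
    (hfl : ∀ k, r₀ ≤ M.rOp k) (hr₀ : 0 < r₀) (hc₁ : 0 ≤ c₁) (hins : M.InsertionRate W κ E₀ δ' θ)
    (hdamp : M.InsertionDampedNat W κ c ω) (hΛ : 0 ≤ Λ) (hδ' : 0 ≤ δ') (hθ : 0 ≤ θ) (hθ1 : θ < 1) (hc : 0 ≤ c)
    (hω : 0 < ω) (hnear : (c₁ / r₀ + δ') * θ ^ k₀ + c * (EA₀ + E₀) / (1 - ω) ≤ ρ₀) (hB : 0 ≤ B)
    (hfirst : ∀ k < k₀, EA₀ + E₀ ≤ B * θ ^ k) (hroom : ω + Λ * c < 1) :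
    ∃ θ', θ' < 1 ∧ ∃ C₅, NE5 EA EB W κ θ' C₅ :=
  ⟨max θ ((ω + Λ * c + 1) / 2), max_lt hθ1 (by linarith), _,
    ne5_at_of_entrywise_lip_nat M hrA hrB hbase hlip hdA hdB hent hunit hfl hr₀ hc₁ hins hdamp hΛ hδ' hθ (le_max_left _ _)
      (max_le hθ1.le (by linarith)) hc hω hnear hB hfirst (lt_max_of_lt_right (by linarith))⟩

end Exists

/-! ## §5b [III]-type shrinking margins cost RATE, not EXISTENCE -/

section ShrinkingMargins

variable {C : Carriers} {Op Hist : Type*} [NormedAddCommGroup Op] [NormedSpace ℂ Op] [NormedAddCommGroup Hist]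
  [NormedSpace ℂ Hist] (M : StepModel C Op Hist)

/-- `InsertionRate` (W4) is monotone in the rate: a bound at rate `θ₀` is a bound at every `θ₁ ≥ θ₀`. [folklore] -/
theorem insertionRate_mono {W : Set (ℕ → ℝ)} {κ E₀ δ' θ₀ θ₁ : ℝ} (h : M.InsertionRate W κ E₀ δ' θ₀) (hδ' : 0 ≤ δ')
    (hθ₀ : 0 ≤ θ₀) (hle : θ₀ ≤ θ₁) : M.InsertionRate W κ E₀ δ' θ₁ := by
  intro k g hg U t ht
  refine (h k g hg U t ht).trans ?_
  exact mul_le_mul_of_nonneg_right (mul_le_mul_of_nonneg_left (pow_le_pow_left₀ hθ₀ hle k) hδ') (M.rHist_pos k).le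

/-- The first-scales constant: with `B = max 0 ((EA₀ + E₀)/θ^{k₀})` and `0 < θ ≤ 1`, `EA₀ + E₀ ≤ B·θ^k` for every `k ≤ k₀`.
[folklore] -/
theorem first_scales_const {EA₀ E₀ θ : ℝ} {k₀ : ℕ} (hθ0 : 0 < θ) (hθ1 : θ ≤ 1) {k : ℕ} (hk : k ≤ k₀) :
    EA₀ + E₀ ≤ max 0 ((EA₀ + E₀) / θ ^ k₀) * θ ^ k := by
  have hpk : 0 < θ ^ k := pow_pos hθ0 k
  have hpk₀ : 0 < θ ^ k₀ := pow_pos hθ0 k₀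
  rcases le_or_gt (EA₀ + E₀) 0 with hneg | hpos
  · exact hneg.trans (mul_nonneg (le_max_left _ _) hpk.le)
  · have hmono : θ ^ k₀ ≤ θ ^ k := pow_le_pow_of_le_one hθ0.le hθ1 hk
    calc EA₀ + E₀ = (EA₀ + E₀) / θ ^ k₀ * θ ^ k₀ := by rw [div_mul_cancel₀ _ hpk₀.ne']
      _ ≤ (EA₀ + E₀) / θ ^ k₀ * θ ^ k := mul_le_mul_of_nonneg_left hmono (div_nonneg hpos.le hpk₀.le)
      _ ≤ max 0 ((EA₀ + E₀) / θ ^ k₀) * θ ^ k := mul_le_mul_of_nonneg_right (le_max_right _ _) hpk.le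

/-- **[III]-TYPE SHRINKING MARGINS COST RATE, NOT EXISTENCE** (the (C5) dichotomy of the node-U3 record `t4/T4-EST-U3.md`, in the
kernel): if W1 is supplied as an ABSOLUTE rate `δ₀θ₀^k` (`AbsOperatorRate`; from `EntrywiseRate` under unit rate factors by the
liaison's `absRate_of_entrywise`) while the operator margins shrink POLYNOMIALLY in the step (`MarginFloorPoly r₀ p`:
`r₀/(k+1)^p ≤ rOp k` — the [III] radii `α_{0,j} = g_jC₀(log g_j^{−2})^{q₀}` type), and the other binders of §2 hold with W2's reach
`ρ₀` STRICTLY above the fed-back one-run level `c(EA₀ + E₀)/(1 − ω)` and with room `ω + Λ·c < 1`, then SOME rate `θ′ < 1` and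
constant give `NE5 EA EB W κ θ′ C₅`.  Route: the liaison's `operatorRate_of_absRate_poly` at the intermediate rate
`θ₁ = (θ₀ + 1)/2` (W1 in margin units with SOME `δ ≥ 0`), W4 moved to `θ₁` (`insertionRate_mono`), the reach scale `k₀` from
`(δ + δ′)θ₁^k → 0`, the first-scales constant `first_scales_const`, then the Data leaf's `ne5_at_of_stepModel_lip_nat` at
`θ′ = max θ₁ ((ω + Λc + 1)/2)`.  The SIZE of `θ′` and of `C₅` is lost to the ∃ — exactly the price the record names ("a
LOGARITHMIC LOSS against a power rate — absorbable by any θ′ > θ"). [folklore] -/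
theorem exists_ne5_of_absRate_poly {EA : Functional C C.BgA} {EB : Functional C C.BgB} {W : Set (ℕ → ℝ)}
    {κ Λ EA₀ E₀ δ₀ r₀ δ' θ₀ c ω ρ₀ : ℝ} {p : ℕ} (hrA : M.RepresentsA EA W) (hrB : M.RepresentsB EB W)
    (hbase : M.InBase EB W) (hlip : M.DataLipschitz W κ Λ ρ₀) (hdA : DecayBound EA W EA₀ κ)
    (hdB : DecayBound EB W E₀ κ) (habs : AbsOperatorRate M W δ₀ θ₀) (hfl : MarginFloorPoly M r₀ p) (hr₀ : 0 < r₀)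
    (hδ₀ : 0 ≤ δ₀) (hins : M.InsertionRate W κ E₀ δ' θ₀) (hdamp : M.InsertionDampedNat W κ c ω) (hΛ : 0 ≤ Λ)
    (hδ' : 0 ≤ δ') (hθ₀ : 0 ≤ θ₀) (hθ₀1 : θ₀ < 1) (hc : 0 ≤ c) (hω : 0 < ω)
    (hreach : c * (EA₀ + E₀) / (1 - ω) < ρ₀) (hroom : ω + Λ * c < 1) :
    ∃ θ', θ' < 1 ∧ ∃ C₅, NE5 EA EB W κ θ' C₅ := by
  -- an intermediate rate strictly between θ₀ and 1
  obtain ⟨hθ₀₁, hθ₁1⟩ : θ₀ < (θ₀ + 1) / 2 ∧ (θ₀ + 1) / 2 < 1 := ⟨by linarith, by linarith⟩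
  set θ₁ : ℝ := (θ₀ + 1) / 2 with hθ₁
  have hθ₁0 : 0 < θ₁ := lt_of_le_of_lt hθ₀ hθ₀₁
  -- W1 in margin units at θ₁ with SOME constant (polynomial absorption), W4 moved to θ₁
  obtain ⟨δ, hδ, hop⟩ := operatorRate_of_absRate_poly M habs hfl hr₀ hδ₀ hθ₀ hθ₀₁
  have hins₁ : M.InsertionRate W κ E₀ δ' θ₁ := insertionRate_mono M hins hδ' hθ₀ hθ₀₁.le
  -- the reach scale k₀
  have ht : Filter.Tendsto (fun k : ℕ => (δ + δ') * θ₁ ^ k) Filter.atTop (nhds 0) := by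
    simpa using (tendsto_pow_atTop_nhds_zero_of_lt_one hθ₁0.le hθ₁1).const_mul (δ + δ')
  have hgap : 0 < ρ₀ - c * (EA₀ + E₀) / (1 - ω) := sub_pos.mpr hreach
  obtain ⟨k₀, hk₀⟩ := (ht.eventually (gt_mem_nhds hgap)).exists
  have hnear : (δ + δ') * θ₁ ^ k₀ + c * (EA₀ + E₀) / (1 - ω) ≤ ρ₀ := by linarith
  -- the first scales
  have hfirst : ∀ k < k₀, EA₀ + E₀ ≤ max 0 ((EA₀ + E₀) / θ₁ ^ k₀) * θ₁ ^ k :=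
    fun k hk => first_scales_const hθ₁0 hθ₁1.le hk.le
  -- the slower-rate face at θ′ = max θ₁ ((ω + Λc + 1)/2)
  exact ⟨max θ₁ ((ω + Λ * c + 1) / 2), max_lt hθ₁1 (by linarith), _,
    M.ne5_at_of_stepModel_lip_nat hrA hrB hbase hlip hdA hdB hop hins₁ hdamp hΛ (add_nonneg hδ hδ') hθ₁0.le
      (le_max_left _ _) (max_le hθ₁1.le (by linarith)) hc hω hnear (le_max_left _ _) hfirst
      (lt_max_of_lt_right (by linarith))⟩

end ShrinkingMargins

/-! ## §6 Non-vacuity on the imported toy, and the negative control -/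

section Toy

/-- NON-VACUITY: on the Data leaf's `toyModel` (absolute operator rate `(1/2)^k` — liaison `toy_absRate` —, unit margins —
`toy_marginFloor` —, exact modulus `Λ = 1` for every reach, gain `c = ω = 1/64`, `δ′ = 0`) the §2 machinery fires through §1's
floor lemma: reach `ρ₀ = 2`, `k₀ = 0`, `B = 0`, `θ = θ′ = 1/2`, smallness `1/64 + 1/64 < 1/2`, constant `31/30` — the Data leaf's
`toy_ne5Data_lip`, reached here with W1 supplied in the ABSOLUTE currency instead of being assumed in margin units. [folklore] -/
theorem toy_ne5_of_absRate : NE5 toyEA₂ toyEB (Set.univ : Set (ℕ → ℝ)) 0 (1 / 2)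
    ((1 * (1 / 1 + 0) + 0) * (1 / 2 - 1 / 64) / (1 / 2 - (1 / 64 + 1 * (1 / 64)))) :=
  toyModel.ne5_at_of_stepModel_lip_nat (ρ₀ := 2) (B := 0) (k₀ := 0) toy_representsA toy_representsB toy_inBase
    (toy_dataLipschitz 2) toy_decayA toy_decayB
    (operatorRate_of_absRate_floor toyModel toy_absRate (r₀ := 1) (fun k => by simpa using toy_marginFloor k) one_pos
      zero_le_one (by norm_num))
    toy_insertionRate toy_insertionDampedNat (by norm_num) (by norm_num) (by norm_num) le_rfl (by norm_num) (by norm_num)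
    (by norm_num) (by norm_num) le_rfl (fun k hk => absurd hk (Nat.not_lt_zero k)) (by norm_num)

/-- The toy constant in lowest terms. [folklore] -/
example : ((1 * (1 / 1 + 0) + 0) * (1 / 2 - 1 / 64) / (1 / 2 - (1 / 64 + 1 * (1 / 64))) : ℝ) = 31 / 30 := by norm_num

/-- NEGATIVE CONTROL (liaison (L2) BY NAME): the liaison's two-entry `finestToyModel` — a unit-site entry `(1/2)^k` AND a
lattice-site entry with the persistent artefact `1/10`, margins `1` — has NO W1 `OperatorRate univ δ θ` with `0 ≤ θ < 1`,
whatever `δ`; so no face of this module can be fed from it at a rate `θ < 1`.  An instantiation of `EntrywiseRate` for §2 must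
therefore list only operator species localised at unit-size (recent-window) sites — the persistent species belong to the
spine's WEIGHT channel (node U5c), not to a rate binder.  (An `example`, citing the liaison's theorem BY NAME; nothing is
re-declared.) [folklore] -/
example {δ θ : ℝ} (hθ0 : 0 ≤ θ) (hθ1 : θ < 1) : ¬ finestToyModel.OperatorRate Set.univ δ θ :=
  finestToy_not_operatorRate hθ0 hθ1

end Toy

end Summit.QuantumFields.BalabanUV.T4Continuum.OutputRateResidual

end
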